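/-
Copyright (c) 2026. All rights reserved.
Released under Apache 2.0 license as described in the file LICENSE.
-/
import Summits.ValiantsHypothesis.ValiantsHypothesis.Theorems.RoundCircuits
import Summits.ValiantsHypothesis.ValiantsHypothesis.Theorems.SuccinctCirculationHashing
import Summits.ValiantsHypothesis.ValiantsHypothesis.Theorems.IsolationRounds
import Summits.ValiantsHypothesis.ValiantsHypothesis.Theorems.ReadOnceCFSupport

/-!
# Constant-free read-once determinants are hit by the VNP column (succinct FGT16 isolation)

Stage S4c-ii-b, the last of the O-L2-14 isolation series
[cite: FennerGurjarThierauf2016, Theorem 3.1 and Section 3.2] through the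
[cite: ForbesShpilkaVolk2018, §8] dictionary: the door's hypothesis `SmallIsolatingWeights` of
`SuccinctTablesValiantCriterion` is DISCHARGED for a named family, so the family is hit by
`SmallDefinable` through the landed `doorSpec_holds` BY NAME.

* §7 THE ORACLE of S4b from S1 (`exists_cktSize_circ_ne_zero`) padded to a fixed width
  (`RoundCircuits.padBits`): `oracle_inst`.
* §8 THE FAMILY `readOnceCFDets` and the HEADLINES `smallIsolatingWeights_readOnceCF`
  (S1 oracle → S4b rounds `exists_isolating_rounds` on the template of `ReadOnceCFSupport` →
  S4c-i `exists_circuit_ofBits_eq_sum` → `IsolatesMin`) and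
  `readOnceCFDets_hit := doorSpec_holds … BY NAME`.
Currency: kernel-certified rung on the W4 ladder in the VNP column (the constant-free slice of
item 20152's family); closes no item; ONE new family definition `readOnceCFDets`, no facts, no
doors of its own.
-/

set_option linter.dupNamespace false

namespace Summit.ValiantsHypothesis.ValiantsHypothesis.Theorems.ReadOnceCFIsolation

open MvPolynomial Literature.Barriers.ValiantsHypothesis
  Literature.Computability.AlgebraicComplexity Literature.Computability.Complexity CircuitArith
  BoolGadgets SuccinctTables SuccinctCirculationHashing IsolationRounds RoundCircuits
  ReadOnceCFSupport

/-! ### §7 The oracle of S4b from S1 -/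

/-- **The oracle.** S1's succinct circulation hashing, padded to a fixed width `B ≥ ℓ`, answers the
oracle hypothesis `horacle` of `exists_isolating_rounds` with
`Good w := ∃ f, CktSize B2 f (1 + s) ∧ w = ofBits ∘ f ∘ bitsOf`.
[cite: FennerGurjarThierauf2016, Lemma 2.3] -/
theorem oracle_inst {n r s ℓ B N : ℕ} (hB : ℓ ≤ B) (hn : 1 ≤ n) (hN : (r + r) ^ 4 ≤ N)
    (hS1 : ∀ S : Finset (degLEMonomials n → ℤ), S.card ≤ N → (∀ π ∈ S, π ≠ 0) →
      (∀ π ∈ S, ∀ μ, (π μ).natAbs ≤ n) →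
      ∃ (ℓ' : ℕ) (f : (Fin n × Fin (kBits n) → Bool) → Fin ℓ' → Bool), ℓ' ≤ ℓ ∧
        CktSize B2 f s ∧ ∀ π ∈ S, circ (fun μ => Nat.ofBits (f (bitsOf μ))) π ≠ 0) :
    ∀ S : Finset (degLEMonomials n → ℤ), S.card ≤ (r + r) ^ 4 → (∀ π ∈ S, π ≠ 0) →
      (∀ π ∈ S, ∀ μ, (π μ).natAbs ≤ 1) →
      ∃ w : degLEMonomials n → ℕ,
        (∃ f : (Fin n × Fin (kBits n) → Bool) → Fin B → Bool,
          CktSize B2 f (1 + s) ∧ ∀ μ, w μ = Nat.ofBits (f (bitsOf μ))) ∧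
        (∀ μ, w μ < 2 ^ ℓ) ∧ ∀ π ∈ S, ∑ μ, π μ * (w μ : ℤ) ≠ 0 := by
  intro S hS h0 h1
  obtain ⟨ℓ', f, hℓ', hf, hcirc⟩ := hS1 S (hS.trans hN) h0 fun π hπ μ => (h1 π hπ μ).trans hn
  refine ⟨fun μ => Nat.ofBits (f (bitsOf μ)), ⟨padBits B f, cktSize_padBits B hf, fun μ =>
    (ofBits_padBits (hℓ'.trans hB) f (bitsOf μ)).symm⟩, fun μ => ?_, fun π hπ => hcirc π hπ⟩
  exact (Nat.ofBits_lt_two_pow _).trans_le (Nat.pow_le_pow_right (by norm_num) hℓ')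

/-! ### §8 The family, the isolating weights, the rung by the door -/

section Main

variable (F : Type*) [Field F]

/-- CONSTANT-FREE READ-ONCE DETERMINANTS of size `r ≤ binom(2n,n)^a` in the coefficient
variables. This is the sub-family of the read-once determinants of item 20152
(`Theses/BarrierLever.lean` l.1335, `ReadOnceDeterminantsHitByVP : ∀ a, ∃ b n₀, ∀ n ≥ n₀,
IsSuccinctHittingSet (degLEMonomials n) (SmallCircuits ℂ n b) {D | ∃ r E, r ≤ binom(2n,n)^a ∧
read-once ∧ D = (E.map (Sum.elim X C)).det}`) cut out by ONE extra clause — every constant entry is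
`0` — and it is hit here in the VNP column (`SmallDefinable`, not `SmallCircuits`) over every
infinite field of characteristic `0` (not only `ℂ`). [cite: ForbesShpilkaVolk2018, §8] -/
def readOnceCFDets (n a : ℕ) : Set (MvPolynomial (degLEMonomials n) F) :=
  {D | ∃ (r : ℕ) (E : Matrix (Fin r) (Fin r) (degLEMonomials n ⊕ F)),
    r ≤ (Nat.choose (2 * n) n) ^ a ∧
    (∀ p q : Fin r × Fin r, ∀ m, E p.1 p.2 = Sum.inl m → E q.1 q.2 = Sum.inl m → p = q) ∧
    (∀ (i j : Fin r) (c : F), E i j = Sum.inr c → c = 0) ∧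
    D = (E.map (Sum.elim MvPolynomial.X MvPolynomial.C)).det}

/-- **S4c HEADLINE — small-circuit isolating weights for constant-free read-once determinants**
(succinct FGT16: S1 hashing as the oracle of the S4b rounds on the read-once template, the round
circuits juxtaposed by S4c-i, support = admissible permutations by §5).
[cite: FennerGurjarThierauf2016, Theorem 3.1] -/
theorem smallIsolatingWeights_readOnceCF (a : ℕ) :
    ∃ c : ℕ, SmallIsolatingWeights F (fun n => readOnceCFDets F n a) c := by
  obtain ⟨c₁, n₁, hS1⟩ := exists_cktSize_circ_ne_zero 2
  refine ⟨c₁ + 5, max n₁ (8 * a + 4), fun n hn D hD hD0 => ?_⟩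
  have hn₁ : n₁ ≤ n := (le_max_left _ _).trans hn
  have hn8 : 8 * a + 4 ≤ n := (le_max_right _ _).trans hn
  obtain ⟨r, E, hr, hro, hcf, rfl⟩ := hD
  let μ₀ : degLEMonomials n := ⟨0, by simp [degLEMonomials]⟩
  -- the oracle (S1 at level 2, weakened to exponent `c₁ + 1`, padded to width `B`)
  have hS1' : ∀ S : Finset (degLEMonomials n → ℤ), S.card ≤ 2 ^ n ^ 2 → (∀ π ∈ S, π ≠ 0) →
      (∀ π ∈ S, ∀ μ, (π μ).natAbs ≤ n) →
      ∃ (ℓ' : ℕ) (f : (Fin n × Fin (kBits n) → Bool) → Fin ℓ' → Bool), ℓ' ≤ n ^ (c₁ + 1) ∧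
        CktSize B2 f (n ^ (c₁ + 1)) ∧ ∀ π ∈ S, circ (fun μ => Nat.ofBits (f (bitsOf μ))) π ≠ 0 := by
    intro S hS h0 hh
    obtain ⟨ℓ', f, hℓ', hf, hc⟩ := hS1 n hn₁ S hS h0 hh
    have hpow : n ^ c₁ ≤ n ^ (c₁ + 1) := Nat.pow_le_pow_right (by omega) (by omega)
    exact ⟨ℓ', f, hℓ'.trans hpow, hf.of_le hpow, hc⟩
  have horacle := oracle_inst (Nat.le_add_right (n ^ (c₁ + 1)) (2 * n * a)) (by omega)
    (card_bound hr hn8) hS1'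
  -- the rounds (S4b)
  obtain ⟨T, ws, hT, hgood, -, σ, hσ, hiso⟩ :=
    exists_isolating_rounds (varLab_inj μ₀ E hro) horacle (exists_perm_of_det_ne_zero E hcf hD0)
  choose fs hfs hws using hgood
  -- the circuit (S4c-i)
  obtain ⟨Q, out, hQ, hsize, hval⟩ := exists_circuit_ofBits_eq_sum
    ((⟨0, by omega⟩, ⟨0, by unfold kBits; omega⟩) : Fin n × Fin (kBits n)) fs hfs
  have hW : ∀ μ : degLEMonomials n, weightOf Q out μ =
      ∑ t : Fin T, ws t μ * 2 ^ ((n ^ (c₁ + 1) + 2 * n * a) * (T - 1 - ↑t)) := by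
    intro μ
    unfold weightOf
    rw [hval]
    simp_rw [hws]
  have hsz := size_bound (c := c₁ + 1) (by omega) (by omega) (by omega) (hT.trans (rounds_bound hr))
  rw [show c₁ + 1 + 4 = c₁ + 5 from by omega] at hsz
  refine ⟨T * (n ^ (c₁ + 1) + 2 * n * a), Q, out, hQ, hsize.trans hsz,
    (Nat.le_add_left _ _).trans hsz, ?_⟩
  -- isolation of the survivor's monomial
  unfold IsolatesMin
  refine ⟨monoOf (varLab μ₀ E) σ, monoOf_mem_support μ₀ E hro hcf hσ, fun m hm hne => ?_⟩
  obtain ⟨τ, hτ, rfl⟩ := exists_perm_of_mem_support μ₀ E hcf hm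
  have hτσ : τ ≠ σ := fun h => hne (by rw [h])
  rw [sum_monoOf, sum_monoOf]
  simp_rw [hW]
  exact hiso _ (block_bound hr _) τ hτ hτσ

/-- **The census rung (W4, VNP column) for the constant-free slice**, by the landed door
`doorSpec_holds` BY NAME. [cite: ForbesShpilkaVolk2018, §8] -/
theorem readOnceCFDets_hit [CharZero F] [Infinite F] (a : ℕ) :
    ∃ b n₀ : ℕ, ∀ n : ℕ, n₀ ≤ n →
      IsSuccinctHittingSet (degLEMonomials n) (SmallDefinable F n b) (readOnceCFDets F n a) := by
  obtain ⟨c, hc⟩ := smallIsolatingWeights_readOnceCF F a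
  exact doorSpec_holds F (fun n => readOnceCFDets F n a) c hc

end Main

end Summit.ValiantsHypothesis.ValiantsHypothesis.Theorems.ReadOnceCFIsolation
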